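import Literature.IUT.LogVolume.UnitLogWildQuadraticDyadic
import Literature.IUT.LogVolume.UnitLogWildDepth
import Literature.IUT.LogVolume.UnitLogNormTrace
import Literature.IUT.LogVolume.UnitLogUnramifiedDyadicArtinSchreier
import Literature.FieldTheory.FiniteFields.SelfDualPolynomialBasis

/-!
# STUB-IDEAS `stub_heegnerIndexLowerAtTwo` · k = 1 · g30 — «THE SEAM HAS EXACTLY TWO COSETS, AND
# ARTIN–SCHREIER IS A PULLBACK ALONG THE TRACE» (technique: weaken / strengthen)

Stub-ideation sketch (planner seat `sidea-stub_heegnerIndexLowerAtTwo-1-g30`; crux item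
`stmt-BirchSwinnertonDyer-27851` = `PrintCf2.SplitBadTwoLowerHalfOfFacts`; stub of record
`stub_heegnerIndexLowerAtTwo` of `Lines/kside_finite_two.lean` v3 `heegner_index_two`).
BSD is NOT proved here, the stub is NOT proved here; nothing below is proposed to `Theorems/`.

STUB-PLAN v6.1 names, at the universal-norm node `v`, five admissible deliveries (K36): (a) R201′,
(b) the `(3,0)` coset statement `SeamWithUnitClass` PROVED, (c) R196⁗ = trace-coherence of the
Artin–Schreier balls + the universal-norm limit, (d) P21, (e) a located statement-level error.  This file
delivers the STRONGEST PROVABLE FORMS of (b) and of the first half of (c), kernel-checked, and isolates the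
WEAKEST form of each that LOWER consumes:

* §1 **SEAM WITH COSETS (strongest form of k3-g31's S1, = K36 (b) over every frame).**  For ANY involution
  `σ` of a `2`-adic field `L` acting trivially on the residue field and ANY uniformizer `ϖ`, with
  `ζ := ϖ/σϖ` (no torsion hypothesis):
  `log₂(U¹(L)^{N=1}) = (1 − σ)log₂𝒪ˣ ∪ (log₂ ζ + (1 − σ)log₂𝒪ˣ)` and `2·log₂ ζ ∈ (1 − σ)log₂𝒪ˣ`
  (`seamWithUnitClass_holds`), with the DICHOTOMY `log₂(U¹)^{N=1} = (1 − σ)log₂𝒪ˣ ↔ log₂ ζ ∈ (1 − σ)log₂𝒪ˣ`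
  (`image_eq_asymLogUnits_iff`) and k3-g31's torsion seam as the corollary (`image_eq_asymLogUnits_of_torsion`).
  New lever: `σζ = ζ⁻¹`, so `(1 − σ)log₂ ζ = 2 log₂ ζ` — the parity of `k` in the Hilbert-90 normal form
  `1 + x = ϖᵏ·v` is the ONLY obstruction, and `ζ ≡ 1 (mod 𝔪_L)` automatically (`‖ζ − 1‖ < 1` from
  `ζ·σζ = 1` in residue characteristic `2`).
* §2 **ARTIN–SCHREIER IS A PULLBACK ALONG THE TRACE (strongest form of R196⁗, residue and integral
  level).**  For finite fields `k ⊆ k'` of characteristic `2`: `℘(k') = Tr_{k'/k}⁻¹ ℘(k)`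
  (`wp_range_eq_comap_trace`; `℘(c) = c² + c`), hence `Tr ℘(k') = ℘(k)` and the non-trivial class of
  `k'/℘(k') ≅ ℤ/2` maps to the non-trivial class of `k/℘(k)`; and for ANY additive `T : 𝒪' → 𝒪` lifting the
  residue trace, `AS(𝒪') = T⁻¹ AS(𝒪)` (`asLattice_eq_comap`), so `T(AS(𝒪')) = AS(𝒪)` as soon as `T` is onto
  (`asLattice_map_eq_of_surjective`; unramified layers: `Tr 𝒪_{F_{n+1}} = 𝒪_{F_n}`).  Ingredients BY NAME
  from the tree: `TracesAndNorms.trace_eq_zero_iff_exists_pow_card_sub` (additive Hilbert 90, L–N Thm 2.25),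
  `TracesAndNorms.trace_trace_eq` (L–N Thm 2.26), `SelfDualPolynomialBasis.trace_pow_char` (`Tr(c²) = Tr(c)²`).

All theorems below are PROVED (no `sorry`).  The card (`Ideas/stub_heegnerIndexLowerAtTwo-k1.md`,
`STUB-IDEAS-stub_heegnerIndexLowerAtTwo-1-g30.md`) carries the plans, the weakest-sufficient readings for
LOWER (the `(3,0)` coset never enters a universal-norm digit: `Tr(2√3·AS₁) = 2√3·AS₀ = 4√3ℤ₂`), the unproved
helper signatures (the `(3,0)` coset VALUE `log₂ ζ ∈ 2√3ℤ₂ˣ`, the `u ≡ 3 (mod 4)` conductor-4 frame) and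
the Distinguishes-from list.
-/

set_option linter.dupNamespace false

noncomputable section

open Metric Set
open scoped Pointwise
open Literature.IUT.LogVolume
open Literature.NumberTheory.GaloisRepresentations.Ultrametric

namespace Summit.BirchSwinnertonDyer.BirchSwinnertonDyer.Cruxes.SplitBadTwoLowerHalfOfFacts.SeamCosetsK1G30

/-! ## §0 Vocabulary (verbatim from k3-g31 `KeyedLawK3G31` §0/§5, so that `SeamWithUnitClass` below is
literally the typed `(3,0)` target of that sketch) -/

section Seam

variable {L : Type*} [NontriviallyNormedField L] [NormedAlgebra ℚ_[2] L] [IsUltrametricDist L]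
  [ProperSpace L]

/-- `U¹(L)^{N=1}`: principal units of norm one to the fixed field of `σ` (k3-g31 §0). -/
def normOnePrincipal (σ : L ≃ₐ[ℚ_[2]] L) : Set L := {x | ‖1 - x‖ < 1 ∧ x * σ x = 1}

/-- `(1 − σ)·log₂(𝒪_Lˣ)` (k3-g31 §0). -/
def asymLogUnits (σ : L ≃ₐ[ℚ_[2]] L) : Set L := (fun z : L => z - σ z) '' logUnits L

/-- The typed `(3,0)` target of k3-g31 §5, verbatim: the seam carries the unit class `ζ = ϖ/σϖ`. -/
def SeamWithUnitClass (σ : L ≃ₐ[ℚ_[2]] L) (ϖ : Lˣ) : Prop :=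
  unitLog '' normOnePrincipal σ =
    asymLogUnits σ ∪ ((fun w : L => unitLog ((ϖ : L) * (σ (ϖ : L))⁻¹) + w) '' asymLogUnits σ)

omit [NormedAlgebra ℚ_[2] L] [ProperSpace L] in
theorem norm_sub_le_max' (x y : L) : ‖x - y‖ ≤ max ‖x‖ ‖y‖ := by
  rw [sub_eq_add_neg, ← norm_neg y]
  exact IsUltrametricDist.norm_add_le_max x (-y)

variable (σ : L ≃ₐ[ℚ_[2]] L)

/-- `σ` is an isometry (tree `norm_map_algEquiv`). -/
theorem norm_map_sigma (x : L) : ‖σ x‖ = ‖x‖ := by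
  haveI : FiniteDimensional ℚ_[2] L := FiniteDimensional.of_locallyCompactSpace ℚ_[2]
  haveI : Algebra.IsAlgebraic ℚ_[2] L := Algebra.IsAlgebraic.of_finite ℚ_[2] L
  exact norm_map_algEquiv 2 σ x

/-- `log₂ ∘ σ = σ ∘ log₂` (tree `unitLog_map_algEquiv`). -/
theorem unitLog_map_sigma (x : L) : unitLog (σ x) = σ (unitLog x) := by
  haveI : FiniteDimensional ℚ_[2] L := FiniteDimensional.of_locallyCompactSpace ℚ_[2]
  haveI : Algebra.IsAlgebraic ℚ_[2] L := Algebra.IsAlgebraic.of_finite ℚ_[2] L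
  exact unitLog_map_algEquiv 2 σ x

theorem map_ne_zero_sigma {x : L} (hx : x ≠ 0) : σ x ≠ 0 := fun h0 => by
  have h := norm_map_sigma σ x
  rw [h0, norm_zero] at h
  exact hx (norm_eq_zero.mp h.symm)

/-- `log₂(y/σy) = log₂ y − σ(log₂ y)` for a unit `y` (k3-g31 §1). -/
theorem unitLog_mul_inv_sigma {y : L} (hy : ‖y‖ = 1) :
    unitLog (y * (σ y)⁻¹) = unitLog y - σ (unitLog y) := by
  have hσy : ‖σ y‖ = 1 := by rw [norm_map_sigma, hy]
  have hσyi : ‖(σ y)⁻¹‖ = 1 := by rw [norm_inv, hσy, inv_one]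
  rw [unitLog_mul 2 hy hσyi, unitLog_inv 2 hσy, unitLog_map_sigma, sub_eq_add_neg]

/-- SEAM, easy half (k3-g31 §1, verbatim): `(1 − σ)·log₂(𝒪_Lˣ) ⊆ log₂(U¹(L)^{N=1})`. -/
theorem asymLogUnits_subset_image (hσ2 : ∀ x : L, σ (σ x) = x)
    (hσI : ∀ x : L, ‖x‖ ≤ 1 → ‖σ x - x‖ < 1) :
    asymLogUnits σ ⊆ unitLog '' normOnePrincipal σ := by
  rintro w ⟨y, hy, rfl⟩
  obtain ⟨u, hu, rfl⟩ := (mem_logUnits_iff).mp hy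
  have hσu : ‖σ u‖ = 1 := by rw [norm_map_sigma, hu]
  have hσu0 : σ u ≠ 0 := norm_pos_iff.mp (by rw [hσu]; exact one_pos)
  have hu0 : u ≠ 0 := norm_pos_iff.mp (by rw [hu]; exact one_pos)
  refine ⟨u * (σ u)⁻¹, ⟨?_, ?_⟩, unitLog_mul_inv_sigma σ hu⟩
  · have h1 : 1 - u * (σ u)⁻¹ = (σ u - u) * (σ u)⁻¹ := by field_simp
    rw [h1, norm_mul, norm_inv, hσu, inv_one, mul_one]
    exact hσI u hu.le
  · rw [map_mul, map_inv₀, hσ2]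
    field_simp

theorem add_mem_asymLogUnits {a b : L} (ha : a ∈ asymLogUnits σ) (hb : b ∈ asymLogUnits σ) :
    a + b ∈ asymLogUnits σ := by
  obtain ⟨z, hz, rfl⟩ := ha
  obtain ⟨z', hz', rfl⟩ := hb
  refine ⟨z + z', (logUnitsAddSubgroup 2 L).add_mem hz hz', ?_⟩
  show (z + z') - σ (z + z') = (z - σ z) + (z' - σ z')
  rw [map_add]; ring

/-! ## §1 SEAM WITH COSETS — the strongest provable form of the seam (NEW, PROVED)

`ζ := ϖ/σϖ`.  Three facts drive everything: `σζ = ζ⁻¹` (so `(1 − σ)·log₂ ζ = 2·log₂ ζ`), `ζ·σζ = 1`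
(so `ζ ≡ 1 (mod 𝔪_L)`: `ζ² ≡ ζσζ = 1`, and squaring is injective on the residue field), and the
Hilbert-90 normal form `x = ζᵏ·(v/σv)` of k3-g31 §1 — read modulo the PARITY of `k` instead of under
`log₂ ζ = 0`. -/

omit [IsUltrametricDist L] [ProperSpace L] in
/-- `σζ = ζ⁻¹`. -/
theorem sigma_zeta (hσ2 : ∀ x : L, σ (σ x) = x) (ϖ : Lˣ) :
    σ ((ϖ : L) * (σ (ϖ : L))⁻¹) = ((ϖ : L) * (σ (ϖ : L))⁻¹)⁻¹ := by
  rw [map_mul, map_inv₀, hσ2, mul_inv, inv_inv, mul_comm]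

/-- `‖ζ‖ = 1`. -/
theorem norm_zeta (ϖ : Lˣ) : ‖(ϖ : L) * (σ (ϖ : L))⁻¹‖ = 1 := by
  rw [norm_mul, norm_inv, norm_map_sigma, mul_inv_cancel₀ (norm_ne_zero_iff.mpr ϖ.ne_zero)]

/-- `ζ·σζ = 1`: `ζ` is a norm-one unit. -/
theorem zeta_mul_sigma_zeta (hσ2 : ∀ x : L, σ (σ x) = x) (ϖ : Lˣ) :
    ((ϖ : L) * (σ (ϖ : L))⁻¹) * σ ((ϖ : L) * (σ (ϖ : L))⁻¹) = 1 := by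
  have hζ0 : (ϖ : L) * (σ (ϖ : L))⁻¹ ≠ 0 :=
    norm_pos_iff.mp (by rw [norm_zeta σ ϖ]; exact one_pos)
  rw [sigma_zeta σ hσ2 ϖ, mul_inv_cancel₀ hζ0]

/-- **The lever:** for a unit `w` with `σw = w⁻¹`, `(1 − σ)·log₂ w = 2·log₂ w`. -/
theorem unitLog_sub_sigma_of_sigma_eq_inv {w : L} (hw : ‖w‖ = 1) (hσw : σ w = w⁻¹) :
    unitLog w - σ (unitLog w) = 2 * unitLog w := by
  rw [← unitLog_map_sigma, hσw, unitLog_inv 2 hw]; ring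

/-- … hence `2·log₂ w ∈ (1 − σ)·log₂(𝒪_Lˣ)`; in particular `2·log₂ ζ` lies in the lattice. -/
theorem two_mul_unitLog_mem_asymLogUnits {w : L} (hw : ‖w‖ = 1) (hσw : σ w = w⁻¹) :
    2 * unitLog w ∈ asymLogUnits σ :=
  ⟨unitLog w, unitLog_mem_logUnits hw, unitLog_sub_sigma_of_sigma_eq_inv σ hw hσw⟩

theorem two_mul_unitLog_zeta_mem_asymLogUnits (hσ2 : ∀ x : L, σ (σ x) = x) (ϖ : Lˣ) :
    2 * unitLog ((ϖ : L) * (σ (ϖ : L))⁻¹) ∈ asymLogUnits σ :=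
  two_mul_unitLog_mem_asymLogUnits σ (norm_zeta σ ϖ) (sigma_zeta σ hσ2 ϖ)

/-- **`ζ ≡ 1 (mod 𝔪_L)` for free:** `ζσζ = 1` and residue-triviality of `σ` give `‖ζ² − 1‖ < 1`, and
`(ζ − 1)² = (ζ² − 1) − 2(ζ − 1)` with `‖2‖ = 1/2` gives `‖ζ − 1‖² < 1`. -/
theorem norm_zeta_sub_one_lt (hσ2 : ∀ x : L, σ (σ x) = x)
    (hσI : ∀ x : L, ‖x‖ ≤ 1 → ‖σ x - x‖ < 1) (ϖ : Lˣ) :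
    ‖(ϖ : L) * (σ (ϖ : L))⁻¹ - 1‖ < 1 := by
  set ζ : L := (ϖ : L) * (σ (ϖ : L))⁻¹ with hζdef
  have hζ1 : ‖ζ‖ = 1 := norm_zeta σ ϖ
  have hprod : ζ * σ ζ = 1 := zeta_mul_sigma_zeta σ hσ2 ϖ
  have hA : ‖ζ ^ 2 - 1‖ < 1 := by
    have h : ζ ^ 2 - 1 = ζ * (ζ - σ ζ) := by linear_combination hprod
    rw [h, norm_mul, hζ1, one_mul, ← norm_neg, neg_sub]
    exact hσI ζ hζ1.le
  have hle : ‖ζ - 1‖ ≤ 1 := (norm_sub_le_max' _ _).trans (max_le hζ1.le (by rw [norm_one]))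
  have hB : ‖(ζ - 1) ^ 2‖ < 1 := by
    have h : (ζ - 1) ^ 2 = (ζ ^ 2 - 1) - 2 * (ζ - 1) := by ring
    rw [h]
    refine (norm_sub_le_max' _ _).trans_lt (max_lt hA ?_)
    rw [norm_mul, WildDyadic.norm_two]
    calc (2 : ℝ)⁻¹ * ‖ζ - 1‖ ≤ 2⁻¹ * 1 := by gcongr
      _ < 1 := by norm_num
  rw [norm_pow] at hB
  exact (pow_lt_one_iff_of_nonneg (norm_nonneg _) two_ne_zero).mp hB

/-- `ζ ∈ U¹(L)^{N=1}`. -/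
theorem zeta_mem_normOnePrincipal (hσ2 : ∀ x : L, σ (σ x) = x)
    (hσI : ∀ x : L, ‖x‖ ≤ 1 → ‖σ x - x‖ < 1) (ϖ : Lˣ) :
    (ϖ : L) * (σ (ϖ : L))⁻¹ ∈ normOnePrincipal σ :=
  ⟨by rw [← norm_neg, neg_sub]; exact norm_zeta_sub_one_lt σ hσ2 hσI ϖ, zeta_mul_sigma_zeta σ hσ2 ϖ⟩

/-- **SEAM, Hilbert-90 half WITHOUT the torsion hypothesis (PROVED):**
`log₂(U¹(L)^{N=1}) ⊆ (1 − σ)log₂𝒪ˣ ∪ (log₂ ζ + (1 − σ)log₂𝒪ˣ)`.  As in k3-g31 §1, `x = ζᵏ·(v/σv)` from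
`1 + x = ϖᵏ·v`; then `k = 2m`: `log₂ x = (1 − σ)log₂(ζᵐ v)`; `k = 2m+1`: `log₂ x = log₂ ζ + (1 − σ)log₂(ζᵐ v)`. -/
theorem image_subset_cosets (hσ2 : ∀ x : L, σ (σ x) = x) {ϖ : Lˣ} (hϖ : IsUniformizer ϖ) :
    unitLog '' normOnePrincipal σ ⊆
      asymLogUnits σ ∪
        ((fun w : L => unitLog ((ϖ : L) * (σ (ϖ : L))⁻¹) + w) '' asymLogUnits σ) := by
  rintro _ ⟨x, ⟨hxP, hxN⟩, rfl⟩
  have hx1 : ‖x‖ = 1 := IsPrincipal.norm_eq_one hxP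
  have hx0 : x ≠ 0 := norm_pos_iff.mp (by rw [hx1]; exact one_pos)
  have hσx : σ x = x⁻¹ := eq_inv_of_mul_eq_one_right hxN
  by_cases hxm : x = -1
  · refine Or.inl ⟨0, zero_mem_logUnits (p := 2), ?_⟩
    show (0 : L) - σ 0 = unitLog x
    rw [map_zero, sub_zero, hxm]
    exact (unitLog_eq_zero_of_pow_eq_one 2 two_pos (by norm_num : ((-1 : L)) ^ 2 = 1)).symm
  · have ht0 : (1 : L) + x ≠ 0 := fun h => hxm (by linear_combination h)
    have hσt : σ (1 + x) = 1 + x⁻¹ := by rw [map_add, map_one, hσx]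
    have hσt0 : σ (1 + x) ≠ 0 := map_ne_zero_sigma σ ht0
    have h1x0 : (1 : L) + x⁻¹ ≠ 0 := hσt ▸ hσt0
    have hxt : x = (1 + x) * (σ (1 + x))⁻¹ := by
      rw [hσt, eq_mul_inv_iff_mul_eq₀ h1x0, mul_add, mul_one, mul_inv_cancel₀ hx0, add_comm]
    obtain ⟨k, hk⟩ := hϖ.2 (Units.mk0 _ ht0)
    obtain ⟨v, hv1, htv⟩ := exists_eq_zpow_mul_of_norm_eq ϖ (Units.mk0 _ ht0) k hk
    have htv' : (1 : L) + x = (ϖ : L) ^ k * (v : L) := by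
      have h := congrArg Units.val htv
      rwa [Units.val_mk0, Units.val_mul, Units.val_zpow_eq_zpow_val] at h
    have hϖ0 : (ϖ : L) ≠ 0 := ϖ.ne_zero
    have hv0 : (v : L) ≠ 0 := v.ne_zero
    have hσv0 : σ (v : L) ≠ 0 := map_ne_zero_sigma σ hv0
    set ζ : L := (ϖ : L) * (σ (ϖ : L))⁻¹ with hζdef
    have hxdec : x = ζ ^ k * ((v : L) * (σ (v : L))⁻¹) := by
      rw [hxt, htv', map_mul, map_zpow₀, hζdef, mul_inv, mul_zpow, inv_zpow]
      ring
    have hζ1 : ‖ζ‖ = 1 := norm_zeta σ ϖ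
    have hζ0 : ζ ≠ 0 := norm_pos_iff.mp (by rw [hζ1]; exact one_pos)
    have hσζ : σ ζ = ζ⁻¹ := sigma_zeta σ hσ2 ϖ
    have hσv1 : ‖σ (v : L)‖ = 1 := by rw [norm_map_sigma, hv1]
    have hvv1 : ‖(v : L) * (σ (v : L))⁻¹‖ = 1 := by
      rw [norm_mul, norm_inv, hv1, hσv1, inv_one, mul_one]
    -- parity of `k`
    obtain ⟨m, hm⟩ := Int.even_or_odd' k
    have hw1 : ‖ζ ^ m‖ = 1 := by rw [norm_zpow, hζ1, one_zpow]
    have hσw : σ (ζ ^ m) = (ζ ^ m)⁻¹ := by rw [map_zpow₀, hσζ, inv_zpow]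
    have h2w := unitLog_sub_sigma_of_sigma_eq_inv σ hw1 hσw
    have hww1 : ‖ζ ^ m * ζ ^ m‖ = 1 := by rw [norm_mul, hw1, one_mul]
    have hwv1 : ‖ζ ^ m * (v : L)‖ = 1 := by rw [norm_mul, hw1, hv1, one_mul]
    rcases hm with hm | hm
    · -- `k = 2m`: `log₂ x ∈ (1 − σ)log₂𝒪ˣ`
      have hk2 : ζ ^ k = ζ ^ m * ζ ^ m := by rw [hm, mul_comm, zpow_mul, zpow_two]
      refine Or.inl ⟨unitLog (ζ ^ m * (v : L)), unitLog_mem_logUnits hwv1, ?_⟩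
      show unitLog (ζ ^ m * (v : L)) - σ (unitLog (ζ ^ m * (v : L))) = unitLog x
      rw [hxdec, hk2, unitLog_mul 2 hww1 hvv1, unitLog_mul 2 hw1 hw1, unitLog_mul 2 hw1 hv1,
        unitLog_mul_inv_sigma σ hv1, map_add]
      linear_combination h2w
    · -- `k = 2m + 1`: `log₂ x ∈ log₂ ζ + (1 − σ)log₂𝒪ˣ`
      have hk2 : ζ ^ k = ζ ^ m * ζ ^ m * ζ := by
        rw [hm, zpow_add_one₀ hζ0, mul_comm (2 : ℤ) m, zpow_mul, zpow_two]
      have hwwz1 : ‖ζ ^ m * ζ ^ m * ζ‖ = 1 := by rw [norm_mul, hww1, hζ1, one_mul]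
      refine Or.inr ⟨unitLog (ζ ^ m * (v : L)) - σ (unitLog (ζ ^ m * (v : L))),
        ⟨unitLog (ζ ^ m * (v : L)), unitLog_mem_logUnits hwv1, rfl⟩, ?_⟩
      show unitLog ζ + (unitLog (ζ ^ m * (v : L)) - σ (unitLog (ζ ^ m * (v : L)))) = unitLog x
      rw [hxdec, hk2, unitLog_mul 2 hwwz1 hvv1, unitLog_mul 2 hww1 hζ1, unitLog_mul 2 hw1 hw1,
        unitLog_mul 2 hw1 hv1, unitLog_mul_inv_sigma σ hv1, map_add]
      linear_combination h2w

/-- **SEAM, coset half (PROVED):** both cosets occur — `log₂ ζ + (1 − σ)log₂ u = log₂(ζ·u/σu)` and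
`ζ·u/σu ∈ U¹(L)^{N=1}` because `ζ ≡ 1 (mod 𝔪_L)`. -/
theorem cosets_subset_image (hσ2 : ∀ x : L, σ (σ x) = x)
    (hσI : ∀ x : L, ‖x‖ ≤ 1 → ‖σ x - x‖ < 1) (ϖ : Lˣ) :
    asymLogUnits σ ∪ ((fun w : L => unitLog ((ϖ : L) * (σ (ϖ : L))⁻¹) + w) '' asymLogUnits σ) ⊆
      unitLog '' normOnePrincipal σ := by
  rintro y (hy | ⟨w, ⟨z, hz, rfl⟩, rfl⟩)
  · exact asymLogUnits_subset_image σ hσ2 hσI hy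
  · obtain ⟨u, hu, rfl⟩ := (mem_logUnits_iff).mp hz
    set ζ : L := (ϖ : L) * (σ (ϖ : L))⁻¹ with hζdef
    have hζ1 : ‖ζ‖ = 1 := norm_zeta σ ϖ
    have hζ0 : ζ ≠ 0 := norm_pos_iff.mp (by rw [hζ1]; exact one_pos)
    have hσζ : σ ζ = ζ⁻¹ := sigma_zeta σ hσ2 ϖ
    have hσu : ‖σ u‖ = 1 := by rw [norm_map_sigma, hu]
    have hσu0 : σ u ≠ 0 := norm_pos_iff.mp (by rw [hσu]; exact one_pos)
    have hu0 : u ≠ 0 := norm_pos_iff.mp (by rw [hu]; exact one_pos)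
    have huu1 : ‖u * (σ u)⁻¹‖ = 1 := by rw [norm_mul, norm_inv, hu, hσu, inv_one, mul_one]
    refine ⟨ζ * (u * (σ u)⁻¹), ⟨?_, ?_⟩, ?_⟩
    · -- principal: `1 − ζu/σu = ((σu − u) + (1 − ζ)u)/σu`
      have h1 : 1 - ζ * (u * (σ u)⁻¹) = ((σ u - u) + (1 - ζ) * u) * (σ u)⁻¹ := by
        field_simp
        ring
      rw [h1, norm_mul, norm_inv, hσu, inv_one, mul_one]
      refine (IsUltrametricDist.norm_add_le_max _ _).trans_lt (max_lt (hσI u hu.le) ?_)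
      rw [norm_mul, hu, mul_one, ← norm_neg, neg_sub]
      exact norm_zeta_sub_one_lt σ hσ2 hσI ϖ
    · -- norm one
      have hprod : ζ * σ ζ = 1 := zeta_mul_sigma_zeta σ hσ2 ϖ
      rw [map_mul σ ζ, map_mul σ u, map_inv₀ σ (σ u), hσ2 u]
      calc ζ * (u * (σ u)⁻¹) * (σ ζ * (σ u * u⁻¹))
          = (ζ * σ ζ) * ((u * u⁻¹) * (σ u * (σ u)⁻¹)) := by ring
        _ = 1 := by rw [hprod, mul_inv_cancel₀ hu0, mul_inv_cancel₀ hσu0]; ring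
    · rw [unitLog_mul 2 hζ1 huu1, unitLog_mul_inv_sigma σ hu]

/-- **`SeamWithUnitClass σ ϖ` holds for EVERY residue-trivial involution and EVERY uniformizer (K36 (b) at
frame level, PROVED).**  No torsion hypothesis, no conductor hypothesis, no `e = 2`. -/
theorem seamWithUnitClass_holds (hσ2 : ∀ x : L, σ (σ x) = x)
    (hσI : ∀ x : L, ‖x‖ ≤ 1 → ‖σ x - x‖ < 1) {ϖ : Lˣ} (hϖ : IsUniformizer ϖ) :
    SeamWithUnitClass σ ϖ :=
  Subset.antisymm (image_subset_cosets σ hσ2 hϖ) (cosets_subset_image σ hσ2 hσI ϖ)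

/-- **SEAM DICHOTOMY (PROVED):** `[log₂ U¹(L)^{N=1} : (1 − σ)log₂𝒪ˣ] ∈ {1, 2}`, and it is `1` iff
`log₂ ζ ∈ (1 − σ)log₂𝒪ˣ` — the single bit that separates the `(3,0)` table entry `2√3ℤ₂` (bit false:
`log₂ ζ ∈ 2√3ℤ₂ˣ`, `ζ = −(2+√3)`) from every other conductor-4/8 layer (bit true: `ζ` torsion, or
`[k_F : 𝔽₂]` even). -/
theorem image_eq_asymLogUnits_iff (hσ2 : ∀ x : L, σ (σ x) = x)
    (hσI : ∀ x : L, ‖x‖ ≤ 1 → ‖σ x - x‖ < 1) {ϖ : Lˣ} (hϖ : IsUniformizer ϖ) :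
    unitLog '' normOnePrincipal σ = asymLogUnits σ ↔
      unitLog ((ϖ : L) * (σ (ϖ : L))⁻¹) ∈ asymLogUnits σ := by
  constructor
  · intro h
    rw [← h]
    exact ⟨_, zeta_mem_normOnePrincipal σ hσ2 hσI ϖ, rfl⟩
  · intro hζ
    refine Subset.antisymm ((image_subset_cosets σ hσ2 hϖ).trans ?_) (asymLogUnits_subset_image σ hσ2 hσI)
    rintro y (hy | ⟨w, hw, rfl⟩)
    · exact hy
    · exact add_mem_asymLogUnits σ hζ hw

/-- Corollary = k3-g31's torsion seam S1: if `ζ` is torsion then `log₂ ζ = 0` lies in the lattice. -/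
theorem image_eq_asymLogUnits_of_torsion (hσ2 : ∀ x : L, σ (σ x) = x)
    (hσI : ∀ x : L, ‖x‖ ≤ 1 → ‖σ x - x‖ < 1) {ϖ : Lˣ} (hϖ : IsUniformizer ϖ)
    (hζ : ∃ n : ℕ, 0 < n ∧ ((ϖ : L) * (σ (ϖ : L))⁻¹) ^ n = 1) :
    unitLog '' normOnePrincipal σ = asymLogUnits σ := by
  obtain ⟨n, hn, hζn⟩ := hζ
  rw [image_eq_asymLogUnits_iff σ hσ2 hσI hϖ, unitLog_eq_zero_of_pow_eq_one 2 hn hζn]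
  refine ⟨0, zero_mem_logUnits (p := 2), ?_⟩
  show (0 : L) - σ 0 = 0
  rw [map_zero, sub_zero]

end Seam

/-! ## §2 ARTIN–SCHREIER IS A PULLBACK ALONG THE TRACE (R196⁗ first half, strongest form, PROVED)

Residue level: `℘(k) = ker Tr_{k/𝔽₂}` (additive Hilbert 90, tree) and `Tr_{k'/𝔽₂} = Tr_{k/𝔽₂} ∘ Tr_{k'/k}`
(tree) give `℘(k') = Tr_{k'/k}⁻¹ ℘(k)` — sharper than "`Tr ℘(k') = ℘(k)`": the class in `k'/℘(k') ≅ ℤ/2`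
is READ OFF by the trace.  Integral level: `AS(𝒪) := red⁻¹ ℘(k)`; any additive lift `T` of the residue
trace satisfies `AS(𝒪') = T⁻¹ AS(𝒪)` (no hypothesis `T 𝔪' = 𝔪` is needed), hence `T AS(𝒪') = AS(𝒪)` for
`T` onto. -/

section ArtinSchreier

/-- `℘ : c ↦ c² + c`, additive in characteristic `2` (k1-g28 §C `artinSchreierHom`). -/
def wp (k : Type*) [CommRing k] [CharP k 2] : k →+ k where
  toFun z := z ^ 2 + z
  map_zero' := by simp
  map_add' x y := by rw [CharTwo.add_sq]; ring

@[simp] theorem wp_apply (k : Type*) [CommRing k] [CharP k 2] (z : k) : wp k z = z ^ 2 + z := rfl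

/-- `c ∈ ℘(k) ↔ Tr_{k/𝔽₂}(c) = 0` — additive Hilbert 90 BY NAME from the tree
(`TracesAndNorms.trace_eq_zero_iff_exists_pow_card_sub`, Lidl–Niederreiter Thm 2.25; as in k1-g28 §C). -/
theorem mem_wp_range_iff_trace_eq_zero (k : Type*) [Field k] [Fintype k] [CharP k 2]
    [Algebra (ZMod 2) k] (c : k) :
    c ∈ (wp k).range ↔ Algebra.trace (ZMod 2) k c = 0 := by
  rw [Literature.FieldTheory.FiniteFields.TracesAndNorms.trace_eq_zero_iff_exists_pow_card_sub
    (ZMod 2) k c, ZMod.card, AddMonoidHom.mem_range]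
  simp only [wp_apply, CharTwo.sub_eq_add]
  constructor <;> rintro ⟨z, hz⟩ <;> exact ⟨z, hz.symm⟩

variable (k k' : Type*) [Field k] [Fintype k] [Field k'] [Fintype k'] [Algebra k k']
  [CharP k 2] [CharP k' 2] [Algebra (ZMod 2) k] [Algebra (ZMod 2) k'] [IsScalarTower (ZMod 2) k k']

/-- The scalar-tower hypothesis is automatic (ring maps out of `𝔽₂` are unique); recorded so that the
instance arguments above are visibly harmless. -/
theorem isScalarTower_zmod_two (K K' : Type*) [Field K] [Field K'] [Algebra K K'] [CharP K 2] [CharP K' 2]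
    [Algebra (ZMod 2) K] [Algebra (ZMod 2) K'] : IsScalarTower (ZMod 2) K K' :=
  IsScalarTower.of_algebraMap_eq' (Subsingleton.elim _ _)

omit [Algebra (ZMod 2) k] [Algebra (ZMod 2) k'] [IsScalarTower (ZMod 2) k k'] in
/-- `Tr(c² + c) = Tr(c)² + Tr(c)`: the trace commutes with `℘` (`Tr(c²) = Tr(c)²`, tree
`SelfDualPolynomialBasis.trace_pow_char`). -/
theorem trace_wp (c : k') : Algebra.trace k k' (wp k' c) = wp k (Algebra.trace k k' c) := by
  rw [wp_apply, wp_apply, map_add,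
    Literature.FieldTheory.FiniteFields.SelfDualPolynomialBasis.trace_pow_char k k' 2 c]

/-- **PULLBACK (residue level, PROVED):** `℘(k') = Tr_{k'/k}⁻¹ ℘(k)`. -/
theorem wp_range_eq_comap_trace :
    (wp k').range = (wp k).range.comap (Algebra.trace k k').toAddMonoidHom := by
  ext x
  rw [AddSubgroup.mem_comap, mem_wp_range_iff_trace_eq_zero k' x, LinearMap.toAddMonoidHom_coe,
    mem_wp_range_iff_trace_eq_zero k,
    Literature.FieldTheory.FiniteFields.TracesAndNorms.trace_trace_eq (ZMod 2) k k' x]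

/-- **TRACE-COHERENCE (residue level, PROVED):** `Tr_{k'/k} ℘(k') = ℘(k)` (trace onto, tree
`TracesAndNorms.trace_surjective_onto`). -/
theorem wp_range_map_trace :
    (wp k').range.map (Algebra.trace k k').toAddMonoidHom = (wp k).range := by
  rw [wp_range_eq_comap_trace k k']
  exact AddSubgroup.map_comap_eq_self_of_surjective
    (Literature.FieldTheory.FiniteFields.TracesAndNorms.trace_surjective_onto k k') _

/-- The non-trivial class goes to the non-trivial class: `x ∉ ℘(k') ↔ Tr x ∉ ℘(k)` (so along an
unramified tower the quotients `k_n/℘(k_n) ≅ ℤ/2` form the CONSTANT system under the traces). -/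
theorem not_mem_wp_range_iff_trace (x : k') :
    x ∉ (wp k').range ↔ Algebra.trace k k' x ∉ (wp k).range := by
  rw [wp_range_eq_comap_trace k k']
  rfl

/-- `AS(𝒪) := red⁻¹ ℘(k)` for a reduction map `red : 𝒪 → k` (k1-g28's `wpLattice`; for `𝒪 = 𝒪_F`,
`k = k_F` this is k3-g31's `artinSchreierBall`, an index-`2` subgroup of `𝒪_F` containing `𝔪_F`). -/
def asLattice {O κ : Type*} [CommRing O] [CommRing κ] [CharP κ 2] (red : O →+* κ) : AddSubgroup O :=
  (wp κ).range.comap red.toAddMonoidHom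

theorem mem_asLattice {O κ : Type*} [CommRing O] [CommRing κ] [CharP κ 2] (red : O →+* κ) (a : O) :
    a ∈ asLattice red ↔ red a ∈ (wp κ).range := Iff.rfl

variable {k k'}

/-- **PULLBACK (integral level, PROVED):** if an additive `T : 𝒪' → 𝒪` lifts the residue trace
(`red ∘ T = Tr_{k'/k} ∘ red'`; e.g. `T = Tr_{F'/F}` on `𝒪_{F'}` for finite `F'/F`), then `AS(𝒪') = T⁻¹ AS(𝒪)`. -/
theorem asLattice_eq_comap {O O' : Type*} [CommRing O] [CommRing O'] (red : O →+* k) (red' : O' →+* k')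
    (T : O' →+ O) (hT : ∀ a : O', red (T a) = Algebra.trace k k' (red' a)) :
    asLattice red' = (asLattice red).comap T := by
  ext a
  show red' a ∈ (wp k').range ↔ red (T a) ∈ (wp k).range
  rw [hT, wp_range_eq_comap_trace k k']
  rfl

/-- **TRACE-COHERENCE OF THE ARTIN–SCHREIER BALLS (integral level, PROVED):** with `T` onto (unramified
layers: `Tr_{F_{n+1}/F_n} 𝒪_{F_{n+1}} = 𝒪_{F_n}`), `T AS(𝒪') = AS(𝒪)` — R196⁗'s `Tr(AS_{n+1}) = AS_n`.  This ONTO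
direction is the one that makes `(AS_n, Tr)` a SURJECTIVE inverse system with constant quotient `ℤ/2`, hence
puts `2` in the layer-`0` image of `lim AS_n` (B49's `c`-side datum `2 ∈ 𝔟 + (γ−1)`, colength `≤ 1`). -/
theorem asLattice_map_eq_of_surjective {O O' : Type*} [CommRing O] [CommRing O'] (red : O →+* k)
    (red' : O' →+* k') (T : O' →+ O) (hT : ∀ a : O', red (T a) = Algebra.trace k k' (red' a))
    (hsurj : Function.Surjective T) :
    (asLattice red').map T = asLattice red := by
  rw [asLattice_eq_comap red red' T hT]
  exact AddSubgroup.map_comap_eq_self_of_surjective hsurj _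

/-- One-sided form, no surjectivity: `T AS(𝒪') ⊆ AS(𝒪)` for ANY additive lift `T` of the residue trace
(so at key `3` every norm from a layer `m ≥ 1` has `log₂` in `2√3·AS(ℤ₂) = 4√3ℤ₂` at layer `0`: the `(3,0)`
coset `log₂ζ + 4√3ℤ₂` never meets a universal norm — E3 as a theorem). -/
theorem asLattice_map_le {O O' : Type*} [CommRing O] [CommRing O'] (red : O →+* k) (red' : O' →+* k')
    (T : O' →+ O) (hT : ∀ a : O', red (T a) = Algebra.trace k k' (red' a)) :
    (asLattice red').map T ≤ asLattice red := by
  rw [asLattice_eq_comap red red' T hT]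
  exact AddSubgroup.map_comap_le T _

/-- … and the class is carried identically: `a ∉ AS(𝒪') ↔ T a ∉ AS(𝒪)` (the constant system
`𝒪_{F_n}/AS_n ≅ ℤ/2` under the traces; its limit is the index-`2` quotient `Λ_v/𝔪_v`, k1-g29 §D). -/
theorem not_mem_asLattice_iff {O O' : Type*} [CommRing O] [CommRing O'] (red : O →+* k) (red' : O' →+* k')
    (T : O' →+ O) (hT : ∀ a : O', red (T a) = Algebra.trace k k' (red' a)) (a : O') :
    a ∉ asLattice red' ↔ T a ∉ asLattice red := by
  rw [asLattice_eq_comap red red' T hT]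
  rfl

end ArtinSchreier

end Summit.BirchSwinnertonDyer.BirchSwinnertonDyer.Cruxes.SplitBadTwoLowerHalfOfFacts.SeamCosetsK1G30
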